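import Summits.MatrixMultiplication.OmegaCensus.STPPCriticalPairsZ46

/-!
# ω-census (abelian STPP census): critical pairs in `ℤ/46ℤ` — an AP sum forces AP summands (kernel)

HONEST FRAMING (pub-omega census; verbatim): lottery ticket; floor = certified bounds/negative ranges.
Census STRUCTURE (seat pub-omega-stpp-2 gen 32, 2026-08-30), family (b2); companion of `STPPCriticalPairsZ46.lean`.  If `A + T` is an arithmetic
progression `{p, …, p + 13d}` of `14` distinct terms of `ℤ/46ℤ` and `(|A|, |T|) = (3, 12)` or `(2, 13)`, then `A` and `T` are progressions of the
same difference `d` (`isAP_of_add_eq_apFinset_three/_two`).  Proof: coordinates along the progression from a representation `p = a⋆ + t⋆`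
(`exists_index_sets`; the index arithmetic `i•d = l•d ⇒ i = l ∨ i = l + 23` for `2d ≠ 0` and the window bookkeeping are kernel decisions over
`[0,14)`).  Nothing here is progress on `ω`.

References: J. H. B. Kemperman, Acta Math. 103 (1960), Thm 2.1; M. B. Nathanson, GTM 165, §2.5 (tree: `apFinset`, `IsAP`).
-/

open Finset
open scoped Pointwise

namespace Summit.MatrixMultiplication.OmegaCensus.Z46

open Literature.Combinatorics.Additive

/-! ## §3 An arithmetic-progression sum forces arithmetic-progression summands (sizes `(3,12)` and `(2,13)`) -/

section APSum

/-- Index arithmetic in `ℤ/46ℤ`: if `2d ≠ 0` (so `d` has order `23` or `46`) then `i•d = l•d` with `i < 27`, `l < 14` forces `i = l` or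
`i = l + 23` (kernel decision over the `45 · 27 · 14` instances). [folklore] -/
theorem nsmul_eq_nsmul_index : ∀ d : ZMod 46, 2 • d ≠ 0 → ∀ i < 27, ∀ l < 14, i • d = l • d → (i = l ∨ i = l + 23) := by
  set_option maxRecDepth 100000 in decide +kernel

/-- A progression with `14` distinct terms has a common difference of order `> 2` (basepoint `0`; kernel decision). [folklore] -/
theorem two_nsmul_ne_zero_of_card_apFinset_zero : ∀ d : ZMod 46, #(apFinset (0 : ZMod 46) d 14) = 14 → 2 • d ≠ 0 := by
  set_option maxRecDepth 100000 in decide +kernel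

/-- A progression with `14` distinct terms has a common difference of order `> 2`. [folklore] -/
theorem two_nsmul_ne_zero_of_card_apFinset (p d : ZMod 46) (h : #(apFinset p d 14) = 14) : 2 • d ≠ 0 := by
  apply two_nsmul_ne_zero_of_card_apFinset_zero d
  have e : apFinset p d 14 = p +ᵥ apFinset (0 : ZMod 46) d 14 := by rw [vadd_apFinset, add_zero]
  rw [e, Finset.card_vadd_finset] at h
  exact h

/-- Window bookkeeping, size `12`: a `12`-subset `J ⊆ [0,14)` with `i + J ⊆ [0,14) ∪ [23, ∞)` has `i ≤ 2`. [folklore] -/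
theorem index_le_two : ∀ J ∈ (Finset.range 14).powersetCard 12, ∀ i < 14, (∀ j ∈ J, i + j < 14 ∨ 23 ≤ i + j) → i ≤ 2 := by
  set_option maxRecDepth 100000 in decide +kernel

/-- Window bookkeeping, size `12`: `2 + J ⊆ [0,14) ∪ [23,∞)` forces `J = [0,12)`. [folklore] -/
theorem eq_range12 : ∀ J ∈ (Finset.range 14).powersetCard 12, (∀ j ∈ J, 2 + j < 14 ∨ 23 ≤ 2 + j) → J = Finset.range 12 := by
  set_option maxRecDepth 100000 in decide +kernel

/-- Window bookkeeping, size `13`: a `13`-subset `J ⊆ [0,14)` with `i + J ⊆ [0,14) ∪ [23, ∞)` has `i ≤ 1`. [folklore] -/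
theorem index_le_one : ∀ J ∈ (Finset.range 14).powersetCard 13, ∀ i < 14, (∀ j ∈ J, i + j < 14 ∨ 23 ≤ i + j) → i ≤ 1 := by
  set_option maxRecDepth 100000 in decide +kernel

/-- Window bookkeeping, size `13`: `1 + J ⊆ [0,14) ∪ [23,∞)` forces `J = [0,13)`. [folklore] -/
theorem eq_range13 : ∀ J ∈ (Finset.range 14).powersetCard 13, (∀ j ∈ J, 1 + j < 14 ∨ 23 ≤ 1 + j) → J = Finset.range 13 := by
  set_option maxRecDepth 100000 in decide +kernel

/-- A `3`-subset of `[0,14)` all of whose elements are `≤ 2` is `[0,3)`. [folklore] -/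
theorem eq_range3 {I : Finset ℕ} (hI : #I = 3) (h : ∀ i ∈ I, i ≤ 2) : I = Finset.range 3 :=
  Finset.eq_of_subset_of_card_le (fun i hi => Finset.mem_range.2 (by have := h i hi; omega)) (by rw [Finset.card_range, hI])

/-- A `2`-subset all of whose elements are `≤ 1` is `[0,2)`. [folklore] -/
theorem eq_range2 {I : Finset ℕ} (hI : #I = 2) (h : ∀ i ∈ I, i ≤ 1) : I = Finset.range 2 :=
  Finset.eq_of_subset_of_card_le (fun i hi => Finset.mem_range.2 (by have := h i hi; omega)) (by rw [Finset.card_range, hI])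

/-- **Coordinates along a progression.**  If `A + T = {p, p + d, …, p + 13d}` (14 distinct terms) then, choosing `a⋆ ∈ A`, `t⋆ ∈ T` with
`a⋆ + t⋆ = p`, every element of `A` is `a⋆ + i•d` and every element of `T` is `t⋆ + j•d` with `i, j < 14`, and the index sets
`I, J ⊆ [0,14)` (containing `0`, `|I| = |A|`, `|J| = |T|`) satisfy `i + j ∈ [0,14) ∪ [23, 27)` for all `i ∈ I`, `j ∈ J`. [folklore] -/
theorem exists_index_sets {A T : Finset (ZMod 46)} {p d : ZMod 46} (hsum : A + T = apFinset p d 14)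
    (h14 : #(apFinset p d 14) = 14) :
    ∃ a t : ZMod 46, ∃ I J : Finset ℕ, a + t = p ∧ I ⊆ Finset.range 14 ∧ J ⊆ Finset.range 14 ∧ 0 ∈ I ∧ 0 ∈ J ∧
      A = I.image (fun i => a + i • d) ∧ T = J.image (fun j => t + j • d) ∧ #I = #A ∧ #J = #T ∧
      ∀ i ∈ I, ∀ j ∈ J, i + j < 14 ∨ 23 ≤ i + j := by
  have hd : 2 • d ≠ 0 := two_nsmul_ne_zero_of_card_apFinset p d h14
  have hp : p ∈ A + T := by rw [hsum, mem_apFinset]; exact ⟨0, by norm_num, by rw [zero_nsmul, add_zero]⟩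
  obtain ⟨a, ha, t, ht, hat⟩ := Finset.mem_add.1 hp
  -- every element of `A` (resp. `T`) is `a + i•d` (resp. `t + j•d`) with `i, j < 14`
  have hAco : ∀ x ∈ A, ∃ i, i < 14 ∧ x = a + i • d := by
    intro x hx
    have hmem : x + t ∈ A + T := Finset.add_mem_add hx ht
    rw [hsum, mem_apFinset] at hmem
    obtain ⟨i, hi, he⟩ := hmem
    refine ⟨i, hi, ?_⟩
    have : x = p + i • d - t := by rw [he]; abel
    rw [this, ← hat]; abel
  have hTco : ∀ y ∈ T, ∃ j, j < 14 ∧ y = t + j • d := by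
    intro y hy
    have hmem : a + y ∈ A + T := Finset.add_mem_add ha hy
    rw [hsum, mem_apFinset] at hmem
    obtain ⟨j, hj, he⟩ := hmem
    refine ⟨j, hj, ?_⟩
    have : y = p + j • d - a := by rw [he]; abel
    rw [this, ← hat]; abel
  set I := (Finset.range 14).filter (fun i => a + i • d ∈ A) with hIdef
  set J := (Finset.range 14).filter (fun j => t + j • d ∈ T) with hJdef
  have hAeq : A = I.image (fun i => a + i • d) := by
    ext x
    simp only [hIdef, Finset.mem_image, Finset.mem_filter, Finset.mem_range]
    constructor
    · intro hx
      obtain ⟨i, hi, rfl⟩ := hAco x hx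
      exact ⟨i, ⟨hi, hx⟩, rfl⟩
    · rintro ⟨i, ⟨-, hi⟩, rfl⟩; exact hi
  have hTeq : T = J.image (fun j => t + j • d) := by
    ext y
    simp only [hJdef, Finset.mem_image, Finset.mem_filter, Finset.mem_range]
    constructor
    · intro hy
      obtain ⟨j, hj, rfl⟩ := hTco y hy
      exact ⟨j, ⟨hj, hy⟩, rfl⟩
    · rintro ⟨j, ⟨-, hj⟩, rfl⟩; exact hj
  -- injectivity of the coordinates on `[0,14)`
  have hinj : ∀ (c : ZMod 46), Set.InjOn (fun i : ℕ => c + i • d) (Finset.range 14 : Finset ℕ) := by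
    intro c i hi i' hi' (he : c + i • d = c + i' • d)
    simp only [Finset.coe_range, Set.mem_Iio] at hi hi'
    have he' : i • d = i' • d := add_left_cancel he
    rcases nsmul_eq_nsmul_index d hd i (by omega) i' hi' he' with h | h
    · exact h
    · omega
  have hIcard : #I = #A := by
    rw [hAeq, Finset.card_image_of_injOn ((hinj a).mono (by
      intro i hi; exact Finset.mem_coe.2 (Finset.mem_of_mem_filter i (Finset.mem_coe.1 hi))))]
  have hJcard : #J = #T := by
    rw [hTeq, Finset.card_image_of_injOn ((hinj t).mono (by
      intro j hj; exact Finset.mem_coe.2 (Finset.mem_of_mem_filter j (Finset.mem_coe.1 hj))))]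
  refine ⟨a, t, I, J, hat, Finset.filter_subset _ _, Finset.filter_subset _ _, ?_, ?_, hAeq, hTeq, hIcard, hJcard, ?_⟩
  · simp only [hIdef, Finset.mem_filter, Finset.mem_range, zero_nsmul, add_zero]; exact ⟨by norm_num, ha⟩
  · simp only [hJdef, Finset.mem_filter, Finset.mem_range, zero_nsmul, add_zero]; exact ⟨by norm_num, ht⟩
  · intro i hi j hj
    simp only [hIdef, hJdef, Finset.mem_filter, Finset.mem_range] at hi hj
    have hmem : (a + i • d) + (t + j • d) ∈ A + T := Finset.add_mem_add hi.2 hj.2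
    rw [hsum, mem_apFinset] at hmem
    obtain ⟨l, hl, he⟩ := hmem
    have he' : (i + j) • d = l • d := by
      have : p + l • d = p + (i + j) • d := by rw [he, ← hat, add_nsmul]; abel
      exact (add_left_cancel this).symm
    rcases nsmul_eq_nsmul_index d hd (i + j) (by omega) l hl he' with h | h <;> omega

/-- **An AP sum of a `(3,12)` critical pair has AP summands:** if `|A| = 3`, `|T| = 12` and `A + T` is a progression `{p, …, p + 13d}` of
`14` distinct terms, then `A` and `T` are progressions with the same common difference `d`. [cite: Kemperman1960, Thm 2.1] -/
theorem isAP_of_add_eq_apFinset_three {A T : Finset (ZMod 46)} {p d : ZMod 46} (hA : #A = 3) (hT : #T = 12)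
    (hsum : A + T = apFinset p d 14) (h14 : #(apFinset p d 14) = 14) : IsAP A d ∧ IsAP T d := by
  obtain ⟨a, t, I, J, -, hI, hJ, h0I, -, hAeq, hTeq, hIc, hJc, hcl⟩ := exists_index_sets hsum h14
  rw [hA] at hIc; rw [hT] at hJc
  have hJp : J ∈ (Finset.range 14).powersetCard 12 := Finset.mem_powersetCard.2 ⟨hJ, hJc⟩
  have hIle : ∀ i ∈ I, i ≤ 2 := fun i hi =>
    index_le_two J hJp i (Finset.mem_range.1 (hI hi)) (fun j hj => hcl i hi j hj)
  have hIeq : I = Finset.range 3 := eq_range3 hIc hIle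
  have h2I : 2 ∈ I := by rw [hIeq]; exact Finset.mem_range.2 (by norm_num)
  have hJeq : J = Finset.range 12 := eq_range12 J hJp (fun j hj => hcl 2 h2I j hj)
  refine ⟨⟨a, ?_⟩, ⟨t, ?_⟩⟩
  · rw [hA, hAeq, hIeq]; rfl
  · rw [hT, hTeq, hJeq]; rfl

/-- **An AP sum of a `(2,13)` critical pair has AP summands:** if `|C| = 2`, `|S| = 13` and `C + S` is a progression `{p, …, p + 13d}` of `14`
distinct terms, then `C = {c, c + d}` and `S` is a `13`-term progression of difference `d`. [cite: Kemperman1960, Thm 2.1] -/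
theorem isAP_of_add_eq_apFinset_two {C S : Finset (ZMod 46)} {p d : ZMod 46} (hC : #C = 2) (hS : #S = 13)
    (hsum : C + S = apFinset p d 14) (h14 : #(apFinset p d 14) = 14) : IsAP C d ∧ IsAP S d := by
  obtain ⟨a, t, I, J, -, hI, hJ, h0I, -, hCeq, hSeq, hIc, hJc, hcl⟩ := exists_index_sets hsum h14
  rw [hC] at hIc; rw [hS] at hJc
  have hJp : J ∈ (Finset.range 14).powersetCard 13 := Finset.mem_powersetCard.2 ⟨hJ, hJc⟩
  have hIle : ∀ i ∈ I, i ≤ 1 := fun i hi =>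
    index_le_one J hJp i (Finset.mem_range.1 (hI hi)) (fun j hj => hcl i hi j hj)
  have hIeq : I = Finset.range 2 := eq_range2 hIc hIle
  have h1I : 1 ∈ I := by rw [hIeq]; exact Finset.mem_range.2 (by norm_num)
  have hJeq : J = Finset.range 13 := eq_range13 J hJp (fun j hj => hcl 1 h1I j hj)
  refine ⟨⟨a, ?_⟩, ⟨t, ?_⟩⟩
  · rw [hC, hCeq, hIeq]; rfl
  · rw [hS, hSeq, hJeq]; rfl

end APSum

end Summit.MatrixMultiplication.OmegaCensus.Z46
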